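import Literature.NumberTheory.PAdicHodge.CompletedAlgClosurePadicComplex
import Literature.NumberTheory.PAdicHodge.CompletedAlgClosureBaseChange
import Literature.NumberTheory.PAdicHodge.LocalFieldEmbeddingNorm
import Literature.NumberTheory.GaloisRepresentations.AbsGaloisGroupProofs
import HarnessLib

/-!
# `ℂ_F ≃+* ℂ_[p]` along ANY continuous embedding `φ : F → ℚ_p` of a `p`-adic local field
# (the field identification of `CompletedAlgClosurePadicComplex.lean` transported off `F = ℚ_p`)

Topic `NumberTheory/PAdicHodge`; namespace `Literature.NumberTheory.PAdicHodge`. Cell `bsd-print-cf2`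
(HOME `run/shared/lean/pub/bsd-print-cf2/`), width seat `bsd-line-cf2-p1-w7` g11; sequel of the seat's g7 files
`CompletedAlgClosurePadicComplex.lean` (`θ₀ = CompletedAlgClosure.equivPadicComplex p : ℂ_{ℚ_p} ≃+* ℂ_[p]`) and of
`CompletedAlgClosureBaseChange.lean` (`ℂ_K ≅ ℂ_L` along the chosen `K̄ ≅ L̄`).

WHY. The measure side of de Shalit II.4 at `p = 2` (cell files `Theorems/PrintCf2RubinValueTwoEllipticUnitsLocal*.lean`,
`exists_groupDistribution_twisting_eq_induce_ellipticUnitsLocal`) is stated at the completion `F = K_v` of a number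
field at a place `v` of degree one above `p` (`K_v ≅ ℚ_p`, de Shalit's standing situation `𝒪_𝔭 = ℤ_p`), with the
local analytic data read in Mathlib's `ℂ_[p]` through a ring map `θ : ℂ_F →+* ℂ_[p]` of norm `≤ 1` on `𝒪_{ℂ_F}`
which is «the identity on `F = ℚ_p`» (hypotheses `hθ1`, `hΘe` there).  For `F` LITERALLY `ℚ_[p]` the seat's g7 file
gives `θ₀`; this file gives `θ` for every `F` continuously embedded in `ℚ_p` — in particular for `K_v`.

CONSTRUCTION (Neukirch II (3.3), (4.8); Fontaine, Astérisque 223, Exp. II §1.2: `C = \widehat{K̄}` is functorial in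
the valued field `K̄`).  Let `φ : F →+* ℚ_[p]` be continuous, `F` a non-archimedean local field of characteristic `0`
and residue characteristic `p` (`|p|_F < 1`).  Then `ℚ_p / φ(F)` is algebraic
(`algebra_isAlgebraic_of_continuous_algebraMap`), so the chosen `F`-embedding `ι : F̄ → ℚ̄_p`
(`absClosureEmbedding F ℚ_[p]`) is bijective (`absClosureEmbedding_bijective`) and multiplies absolute values in
the exponent, `‖ι x‖ = ‖x‖ ^ c`, `c > 0` (`exists_algNorm_absClosureEmbedding_eq_rpow`); hence it extends to
`e : ℂ_F ≃+* ℂ_{ℚ_p}` with `‖e z‖ = ‖z‖ ^ c` (`exists_completedAlgClosure_ringEquiv`), and `θ := θ₀ ∘ e`.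

* §1 `Padic.valuation_natCast_lt_one'` — `|p|_{ℚ_p} < 1` for the tree's valuative structure (Mathlib
  `Padic.valuation_p_lt_one`), the standing side condition of the norm-comparison files;
* §2 ★ `CompletedAlgClosure.exists_ringEquiv_padicComplex_of_continuous` — for every continuous `φ : F →+* ℚ_[p]`
  with `|p|_F < 1` **there is `θ : ℂ_F ≃+* ℂ_[p]` with**: `θ ∘ (F̄ → ℂ_F) = (ℚ̄_p → ℂ_[p]) ∘ ι` (algebraic elements go
  to algebraic elements through the chosen `ι`); **`θ (algebraMap F ℂ_F a) = φ a`** (`θ` is `φ` on `F`); `‖θ z‖ = ‖z‖ ^ t`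
  for one real `t > 0`; **closed / open unit balls and the unit sphere correspond**; `θ`, `θ⁻¹` continuous;
* §3 the consumer's reading `θ : ℂ_F →+* ℂ_[p]` restricted to statements: `exists_ringHom_padicComplex_of_continuous`
  (`‖θ z‖ ≤ 1` for `‖z‖ ≤ 1`, `‖θ z‖ < 1` for `‖z‖ < 1`, `θ ∘ algebraMap F = coe ∘ φ`).

Theorems only (existence statements; the isomorphism depends on the choices `ι` and Mathlib's rank-one structures,
so no preferred name is introduced); no definition, no named fact, no instance, no `sorry`.  HONEST FRAMING:
bookkeeping between two models of `ℂ_p`; BSD is not advanced by this file.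

## References
* [NeukirchANT1999] J. Neukirch, *Algebraic Number Theory* (1999), Ch. II Prop. (3.3) (equivalent absolute values are
  powers of one another), Thm. (4.8) (unique extension to algebraic extensions of a complete field).
* [FontaineAsterisque223III] J.-M. Fontaine, *Le corps des périodes p-adiques*, Astérisque 223 (1994), Exp. II §1.1–1.2
  (`C = \widehat{K̄}`, functorial in the valued field `K̄`).
* [FontaineOuyang2022] J.-M. Fontaine, Y. Ouyang, *Theory of p-adic Galois representations*, §3.1 (`ℂ_p`).
-/

noncomputable section

open ValuativeRel Field UniformSpace

namespace Literature.NumberTheory.PAdicHodge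

open Literature.NumberTheory.GaloisRepresentations
open Literature.NumberTheory.GaloisRepresentations.IsNonarchimedeanLocalField

/-! ### §1 `|p|_{ℚ_p} < 1` -/

section Padic

variable (p : ℕ) [hp : Fact p.Prime]

/-- `|p|_p < 1` in `ℚ_[p]` for the valuation of Mathlib's valuative structure (natural-number spelling of Mathlib's
`Padic.valuation_p_lt_one`; the `p`-adic absolute value has `|p|_p = 1/p`). [cite: NeukirchANT1999, Ch. II (2.1)] -/
theorem Padic.valuation_natCast_lt_one' : valuation ℚ_[p] (p : ℚ_[p]) < 1 := by
  have h := _root_.Padic.valuation_p_lt_one (valuation ℚ_[p]) (p := p)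
  exact_mod_cast h

end Padic

/-! ### §2 `ℂ_F ≃+* ℂ_[p]` along a continuous `φ : F →+* ℚ_[p]` -/

section Embedding

variable {F : Type} [Field F] [ValuativeRel F] [TopologicalSpace F] [IsNonarchimedeanLocalField F] [CharZero F]
variable (p : ℕ) [hp : Fact p.Prime]

/-- ★ **`ℂ_F ≃+* ℂ_[p]` along a continuous embedding `φ : F → ℚ_p`.**  Let `F` be a non-archimedean local field of
characteristic `0` with `|p|_F < 1` and `φ : F →+* ℚ_[p]` a continuous ring map; give `ℚ_[p]` the `F`-algebra
structure `φ` and let `ι = absClosureEmbedding F ℚ_[p] : F̄ → ℚ̄_p` be the tree's chosen `F`-embedding.  Then there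
is a ring isomorphism `θ : ℂ_F ≃+* ℂ_[p]` (`ℂ_F = CompletedAlgClosure F`, Mathlib's `ℂ_[p]`) such that
(i) `θ` restricted to `F̄` is `ι` followed by `ℚ̄_p ⊆ ℂ_[p]`; (ii) `θ (algebraMap F ℂ_F a) = φ a` for `a ∈ F`;
(iii) `‖θ z‖ = ‖z‖ ^ t` for a real `t > 0`; (iv)–(vi) `‖θ z‖ ≤ 1 ↔ ‖z‖ ≤ 1`, `‖θ z‖ < 1 ↔ ‖z‖ < 1`,
`‖θ z‖ = 1 ↔ ‖z‖ = 1`; (vii) `θ` and `θ⁻¹` are continuous.  (`ℚ_p/φ(F)` is algebraic, so `ι` is bijective and a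
homothety in the exponent for the spectral norms; it extends to `ℂ_F ≃+* ℂ_{ℚ_p}` by uniform continuity, and
`ℂ_{ℚ_p} ≃+* ℂ_[p]` is the tree's `CompletedAlgClosure.equivPadicComplex`.)
[cite: FontaineAsterisque223III, Exp. II §1.2] [cite: NeukirchANT1999, Ch. II (3.3), (4.8)] -/
theorem CompletedAlgClosure.exists_ringEquiv_padicComplex_of_continuous (φ : F →+* ℚ_[p]) (hφ : Continuous φ)
    (hF : valuation F (p : F) < 1) :
    haveI := Padic.isNonarchimedeanLocalField_holds p
    letI : Algebra F ℚ_[p] := φ.toAlgebra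
    ∃ θ : CompletedAlgClosure F ≃+* ℂ_[p],
      (∀ y : AlgebraicClosure F,
        θ (algClosureToC F y) = ((absClosureEmbedding F ℚ_[p] y : PadicAlgCl p) : ℂ_[p])) ∧
      (∀ a : F, θ (algebraMap F (CompletedAlgClosure F) a) = ((φ a : ℚ_[p]) : ℂ_[p])) ∧
      (∃ t : ℝ, 0 < t ∧ ∀ z : CompletedAlgClosure F, ‖θ z‖ = ‖z‖ ^ t) ∧
      (∀ z : CompletedAlgClosure F, ‖θ z‖ ≤ 1 ↔ ‖z‖ ≤ 1) ∧
      (∀ z : CompletedAlgClosure F, ‖θ z‖ < 1 ↔ ‖z‖ < 1) ∧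
      (∀ z : CompletedAlgClosure F, ‖θ z‖ = 1 ↔ ‖z‖ = 1) ∧
      Continuous θ ∧ Continuous θ.symm := by
  haveI := Padic.isNonarchimedeanLocalField_holds p
  letI : Algebra F ℚ_[p] := φ.toAlgebra
  have hcont : Continuous (algebraMap F ℚ_[p]) := hφ
  have hL : valuation ℚ_[p] (p : ℚ_[p]) < 1 := Padic.valuation_natCast_lt_one' p
  -- `ι` is a homothety in the exponent and bijective
  obtain ⟨c, hc, hcx⟩ := exists_algNorm_absClosureEmbedding_eq_rpow (K := F) (L := ℚ_[p]) (ℓ := p) hcont hF hL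
  haveI : Algebra.IsAlgebraic F ℚ_[p] := algebra_isAlgebraic_of_continuous_algebraMap (ℓ := p) hcont hF hL
  have hbij : Function.Bijective (absClosureEmbedding F ℚ_[p]) := absClosureEmbedding_bijective (K := F) (L := ℚ_[p])
  -- the extension `e : ℂ_F ≃+* ℂ_{ℚ_p}`
  obtain ⟨e, he, henorm, -⟩ := exists_completedAlgClosure_ringEquiv (K := F) (L := ℚ_[p]) hbij hc hcx
  -- the tree's identification `θ₀ : ℂ_{ℚ_p} ≃+* ℂ_[p]` and its norm exponent
  obtain ⟨s, hs, -, hsnorm⟩ := CompletedAlgClosure.exists_norm_equivPadicComplex_rpow_eq p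
  refine ⟨e.trans (CompletedAlgClosure.equivPadicComplex p), fun y => ?_, fun a => ?_, ⟨c / s, div_pos hc hs, fun z => ?_⟩,
    fun z => ?_, fun z => ?_, fun z => ?_, ?_, ?_⟩
  · -- (i) on `F̄`
    rw [RingEquiv.trans_apply, he, CompletedAlgClosure.equivPadicComplex_algClosureToC]
  · -- (ii) on `F`
    rw [RingEquiv.trans_apply, ← algClosureToC_algebraMap, he, AlgHom.commutes,
      IsScalarTower.algebraMap_apply F ℚ_[p] (AlgebraicClosure ℚ_[p]), algClosureToC_algebraMap,
      CompletedAlgClosure.equivPadicComplex_algebraMap]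
    rfl
  · -- (iii) the norm law with exponent `c / s`
    have h1 : ‖CompletedAlgClosure.equivPadicComplex p (e z)‖ ^ s = ‖z‖ ^ c := by rw [hsnorm, henorm]
    rw [RingEquiv.trans_apply]
    have h2 : ‖CompletedAlgClosure.equivPadicComplex p (e z)‖ =
        (‖CompletedAlgClosure.equivPadicComplex p (e z)‖ ^ s) ^ s⁻¹ :=
      (Real.rpow_rpow_inv (norm_nonneg _) hs.ne').symm
    rw [h2, h1, ← Real.rpow_mul (norm_nonneg _), div_eq_mul_inv]
  · -- (iv) closed unit balls
    rw [RingEquiv.trans_apply, CompletedAlgClosure.norm_equivPadicComplex_le_one_iff, henorm, ← Real.one_rpow c,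
      Real.rpow_le_rpow_iff (norm_nonneg _) zero_le_one hc, Real.one_rpow]
  · -- (v) open unit balls
    rw [RingEquiv.trans_apply, CompletedAlgClosure.norm_equivPadicComplex_lt_one_iff, henorm, ← Real.one_rpow c,
      Real.rpow_lt_rpow_iff (norm_nonneg _) zero_le_one hc, Real.one_rpow]
  · -- (vi) the unit sphere
    rw [RingEquiv.trans_apply, CompletedAlgClosure.norm_equivPadicComplex_eq_one_iff, henorm, ← Real.one_rpow c,
      Real.rpow_left_inj (norm_nonneg _) zero_le_one hc.ne', Real.one_rpow]
  · -- (vii) continuity of `θ`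
    have hec : Continuous e := (uniformContinuous_of_norm_map_eq_rpow e hc henorm).continuous
    exact (CompletedAlgClosure.continuous_equivPadicComplex p).comp hec
  · -- continuity of `θ⁻¹`
    have hesymm : ∀ y, ‖e.symm y‖ = ‖y‖ ^ c⁻¹ := fun y => by
      have h := henorm (e.symm y)
      rw [RingEquiv.apply_symm_apply] at h
      rw [h, Real.rpow_rpow_inv (norm_nonneg _) hc.ne']
    have hesc : Continuous e.symm := (uniformContinuous_of_norm_map_eq_rpow e.symm (inv_pos.2 hc) hesymm).continuous
    exact hesc.comp (CompletedAlgClosure.continuous_equivPadicComplex_symm p)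

/-! ### §3 The consumer's reading: a ring map `θ : ℂ_F →+* ℂ_[p]` of norm `≤ 1` on `𝒪_{ℂ_F}`, equal to `φ` on `F` -/

/-- **A reading `θ : ℂ_F →+* ℂ_[p]` over `φ`** (the shape consumed by the measure-side files of the cell:
`hθ1 : ‖θ z‖ ≤ 1` on the closed unit ball, strictness on the open unit ball, and `θ ∘ algebraMap F = coe ∘ φ`):
the ring isomorphism of `exists_ringEquiv_padicComplex_of_continuous` read as a ring map.
[cite: FontaineAsterisque223III, Exp. II §1.2] -/
theorem CompletedAlgClosure.exists_ringHom_padicComplex_of_continuous (φ : F →+* ℚ_[p]) (hφ : Continuous φ)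
    (hF : valuation F (p : F) < 1) :
    ∃ θ : CompletedAlgClosure F →+* ℂ_[p],
      (∀ z : CompletedAlgClosure F, ‖z‖ ≤ 1 → ‖θ z‖ ≤ 1) ∧
      (∀ z : CompletedAlgClosure F, ‖z‖ < 1 → ‖θ z‖ < 1) ∧
      (∀ a : F, θ (algebraMap F (CompletedAlgClosure F) a) = ((φ a : ℚ_[p]) : ℂ_[p])) ∧
      Function.Bijective θ ∧ Continuous θ := by
  obtain ⟨θ, -, hF', -, hle, hlt, -, hθc, -⟩ :=
    CompletedAlgClosure.exists_ringEquiv_padicComplex_of_continuous p φ hφ hF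
  exact ⟨θ.toRingHom, fun z hz => (hle z).mpr hz, fun z hz => (hlt z).mpr hz, hF', θ.bijective, hθc⟩

end Embedding

end Literature.NumberTheory.PAdicHodge

end
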